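import Summits.HubbardSuperconductivity.HubbardSuperconductivity.Theorems.NodalWardXYPerturbedXYOrderReduction

/-!
# `PerturbedXYOrder` (stmt-HubbardSuperconductivity-10739) — line `schwarz-inheritance`, stub `stub_ginibreRay`

**The Ginibre ray.** On the cone of non-positive real DIAGONAL kernels `K = −κ_b δ_{bb'}`, `κ_b ≥ 0`, the
crux's conclusion holds UNIFORMLY in the volume `L ≥ 2` and at EVERY amplitude: `Z_K ≠ 0` and
`Re (num_K / Z_K / L⁶) ≥ a₀`, the `K = 0` plateau of the landed `realPlateau`.

Proof.  For this kernel `W_K(θ) = −Σ_b κ_b sin²(∇_b θ)` is real (`gr_Wk_kernel`), so the integrand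
`w_J e^{W_K}` is the positive weight `ρ = exp(J Σ_b cos ∇_b θ − Σ_b κ_b sin² ∇_b θ)`; since
`−κ sin² u = (κ/2) cos 2u − κ/2`, `ρ = e^{−Σ_b κ_b/2} · exp(Σ_b J cos ∇_b θ + Σ_b (κ_b/2) cos 2∇_b θ)` is, after the
change of variables `θ ↦ e^{iθ}` from the angle cube `[0,2π]^Λ` to the torus `U(1)^Λ`
(`setIntegral_angleCube_comp_exp`), a constant times a Ginibre weight for the character family indexed by
`Bond ⊕ Bond`: the bond characters `χ_b = θ̄_x θ_{x+eᵢ}` with couplings `J` and their squares `χ_b²` with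
couplings `κ_b/2 ≥ 0` (`gr_integrand_eq`, `gr_twoPoint_div_eq_ginibreExpect`).  Ginibre's second inequality
(`ginibreExpect_reChar_mono`) switches the couplings `κ_b/2` on starting from `0`, where the expectation is the
`K = 0` rotator two-point function (`odd_twoPoint_div_eq_ginibreExpect`); summing over the `L⁶` pairs gives
`Re cratio_L(J, K) ≥ Re cratio_L(J, 0) ≥ a₀` (`odd_re_cratio_zero`, `realPlateau`), for `J ≥ max J₁ 0`.

The helper lemmas are generic: `gr_Zk_eq_of` / `gr_num_eq_of` / `gr_re_cratio_of` turn `Z_K`, `num_K`, `Re cratio`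
into real angle-cube integrals for ANY kernel whose integrand `w_J e^{W_K}` is (the cast of) a real function, and
`gr_twoPoint_div_eq_ginibreExpect` identifies angle-cube two-point ratios for (a constant times) ANY Ginibre
weight on `U(1)^Λ` with the corresponding Ginibre expectation.
-/

noncomputable section

namespace Summit.HubbardSuperconductivity.HubbardSuperconductivity.Theorems.PerturbedXYOrder

open MeasureTheory Literature.Probability.LatticeModels
open Summit.HubbardSuperconductivity.HubbardSuperconductivity.Theses.NodalWardXY

variable {L : ℕ}

/-! ### Real integrands: `Z_K`, `num_K` and the plateau as real angle-cube integrals -/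

/-- If the perturbed integrand `w_J e^{W_K}` is a real function `ρ`, then `Z_K = ∫_cube ρ`. -/
theorem gr_Zk_eq_of [NeZero L] {J : ℝ} {K : Bond L → Bond L → ℂ} {ρ : (TorusSite 3 L → ℝ) → ℝ}
    (h : ∀ θ, wJ J θ * Complex.exp (Wk K θ) = ((ρ θ : ℝ) : ℂ)) :
    Zk J K = ((∫ θ in cube L, ρ θ : ℝ) : ℂ) := by
  unfold Zk
  simp_rw [h]
  exact integral_complex_ofReal

/-- If the perturbed integrand `w_J e^{W_K}` is a real function `ρ`, then
`num_K = Σ_{x,y} ∫_cube cos(θ_x − θ_y) ρ`. -/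
theorem gr_num_eq_of [NeZero L] {J : ℝ} {K : Bond L → Bond L → ℂ} {ρ : (TorusSite 3 L → ℝ) → ℝ}
    (h : ∀ θ, wJ J θ * Complex.exp (Wk K θ) = ((ρ θ : ℝ) : ℂ)) :
    num J K =
      ((∑ x : TorusSite 3 L, ∑ y : TorusSite 3 L, ∫ θ in cube L, Real.cos (θ x - θ y) * ρ θ : ℝ) : ℂ) := by
  unfold num
  simp_rw [h, ← Complex.ofReal_mul, integral_complex_ofReal, Complex.ofReal_sum]

/-- If the perturbed integrand `w_J e^{W_K}` is a real function `ρ`, the real part of the complex plateau is the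
average of the real two-point ratios: `Re cratio = L⁻⁶ Σ_{x,y} ∫ cos(θ_x − θ_y) ρ / ∫ ρ`. -/
theorem gr_re_cratio_of [NeZero L] {J : ℝ} {K : Bond L → Bond L → ℂ} {ρ : (TorusSite 3 L → ℝ) → ℝ}
    (h : ∀ θ, wJ J θ * Complex.exp (Wk K θ) = ((ρ θ : ℝ) : ℂ)) :
    (cratio L J K).re =
      (∑ x : TorusSite 3 L, ∑ y : TorusSite 3 L,
        (∫ θ in cube L, Real.cos (θ x - θ y) * ρ θ) / ∫ θ in cube L, ρ θ) / (L : ℝ) ^ 6 := by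
  unfold cratio
  rw [gr_Zk_eq_of h, gr_num_eq_of h]
  have hL : ((L : ℂ)) ^ 6 = (((L : ℝ) ^ 6 : ℝ) : ℂ) := by push_cast; ring
  rw [hL, ← Complex.ofReal_div, ← Complex.ofReal_div, Complex.ofReal_re, Finset.sum_div]
  congr 1
  refine Finset.sum_congr rfl fun x _ => ?_
  rw [Finset.sum_div]

/-! ### Angle cube versus Haar torus for (a constant times) a continuous weight -/

/-- `∫_{[0,2π]^Λ} c · w(e^{iθ}) dθ = c (2π)^{|Λ|} ∫_{U(1)^Λ} w dHaar` for continuous `w`. -/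
theorem gr_setIntegral_cube_const_mul [NeZero L] (c : ℝ) {w : (TorusSite 3 L → Circle) → ℝ}
    (hw : Continuous w) :
    ∫ θ in cube L, c * w (fun v => Circle.exp (θ v)) =
      c * (2 * Real.pi) ^ Fintype.card (TorusSite 3 L) * ∫ u, w u ∂torusHaar (TorusSite 3 L) := by
  unfold cube
  rw [integral_const_mul, setIntegral_angleCube_comp_exp w hw.aestronglyMeasurable, smul_eq_mul, mul_assoc]

/-- `∫_{[0,2π]^Λ} cos(θ_x − θ_y) · c · w(e^{iθ}) dθ = c (2π)^{|Λ|} ∫_{U(1)^Λ} Re(θ̄_y θ_x) w dHaar` for continuous `w`. -/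
theorem gr_setIntegral_cube_cos_const_mul [NeZero L] (c : ℝ) {w : (TorusSite 3 L → Circle) → ℝ}
    (hw : Continuous w) (x y : TorusSite 3 L) :
    ∫ θ in cube L, Real.cos (θ x - θ y) * (c * w (fun v => Circle.exp (θ v))) =
      c * (2 * Real.pi) ^ Fintype.card (TorusSite 3 L) *
        ∫ u, reChar (diffChar y x) u * w u ∂torusHaar (TorusSite 3 L) := by
  have h : ∀ θ : TorusSite 3 L → ℝ, Real.cos (θ x - θ y) * (c * w (fun v => Circle.exp (θ v))) =
      c * (reChar (diffChar y x) (fun v => Circle.exp (θ v)) * w (fun v => Circle.exp (θ v))) := by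
    intro θ
    rw [reChar_diffChar_exp]
    ring
  simp_rw [h]
  exact gr_setIntegral_cube_const_mul c (w := fun u => reChar (diffChar y x) u * w u)
    ((continuous_reChar _).mul hw)

/-- **Angle-cube two-point ratios of a Ginibre weight are Ginibre expectations on `U(1)^Λ`**: for any finite
character family `χ`, couplings `Jc` and constant `c ≠ 0`,
`∫ cos(θ_x − θ_y) c w_{χ,Jc}(e^{iθ}) dθ / ∫ c w_{χ,Jc}(e^{iθ}) dθ = ⟨Re θ̄_y θ_x⟩_{χ,Jc}`
(the factors `c (2π)^{|Λ|}` cancel). -/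
theorem gr_twoPoint_div_eq_ginibreExpect [NeZero L] {ι : Type*} [Fintype ι]
    (χ : ι → (TorusSite 3 L → Circle) →ₜ* Circle) (Jc : ι → ℝ) {c : ℝ} (hc : c ≠ 0) (x y : TorusSite 3 L) :
    (∫ θ in cube L, Real.cos (θ x - θ y) * (c * ginibreWeight χ Jc (fun v => Circle.exp (θ v)))) /
        (∫ θ in cube L, c * ginibreWeight χ Jc (fun v => Circle.exp (θ v))) =
      ginibreExpect (torusHaar (TorusSite 3 L)) χ Jc (reChar (diffChar y x)) := by
  rw [gr_setIntegral_cube_cos_const_mul c (continuous_ginibreWeight χ Jc),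
    gr_setIntegral_cube_const_mul c (continuous_ginibreWeight χ Jc), ginibreExpect,
    mul_div_mul_left _ _ (mul_ne_zero hc (by positivity))]

/-- The angle-cube integral of a positive constant times a Ginibre weight is positive. -/
theorem gr_setIntegral_cube_ginibreWeight_pos [NeZero L] {ι : Type*} [Fintype ι]
    (χ : ι → (TorusSite 3 L → Circle) →ₜ* Circle) (Jc : ι → ℝ) {c : ℝ} (hc : 0 < c) :
    0 < ∫ θ in cube L, c * ginibreWeight χ Jc (fun v => Circle.exp (θ v)) := by
  rw [gr_setIntegral_cube_const_mul c (continuous_ginibreWeight χ Jc)]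
  refine mul_pos (mul_pos hc (by positivity)) ?_
  exact integral_exp_pos
    (integrable_of_continuous_compactSpace (torusHaar (TorusSite 3 L)) (continuous_ginibreWeight _ _))

/-! ### The diagonal kernel: a ferromagnetic second harmonic -/

/-- For the diagonal kernel `K = −κ_b δ_{bb'}`, `W_K(θ) = −Σ_b κ_b j_b(θ)²` is real. -/
theorem gr_Wk_kernel [NeZero L] (κ : Bond L → ℝ) (θ : TorusSite 3 L → ℝ) :
    Wk (fun b b' : Bond L => if b = b' then -((κ b : ℝ) : ℂ) else 0) θ =
      ((-(∑ b : Bond L, κ b * cur b θ ^ 2) : ℝ) : ℂ) := by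
  unfold Wk
  simp only [ite_mul, zero_mul, Finset.sum_ite_eq, Finset.mem_univ, if_true, neg_mul,
    Finset.sum_neg_distrib]
  push_cast
  congr 1
  refine Finset.sum_congr rfl fun b _ => ?_
  ring

/-- `−κ sin² u = (κ/2) cos 2u − κ/2`. -/
theorem gr_neg_mul_sin_sq (k u : ℝ) : -(k * Real.sin u ^ 2) = k / 2 * Real.cos (2 * u) - k / 2 := by
  rw [Real.cos_two_mul]
  linear_combination (-k) * Real.sin_sq_add_cos_sq u

/-- The exponent of the perturbed weight on the ray, rewritten as a ferromagnetic first-plus-second-harmonic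
Hamiltonian minus a constant: `J Σ cos ∇θ − Σ κ sin² ∇θ = −Σ κ/2 + (J Σ cos ∇θ + Σ (κ/2) cos 2∇θ)`. -/
theorem gr_exponent_eq [NeZero L] (κ : Bond L → ℝ) (J : ℝ) (θ : TorusSite 3 L → ℝ) :
    J * ∑ b : Bond L, Real.cos (θ (b.1 + Pi.single b.2 1) - θ b.1) + -(∑ b : Bond L, κ b * cur b θ ^ 2) =
      -(∑ b : Bond L, κ b / 2) +
        (J * ∑ b : Bond L, Real.cos (θ (b.1 + Pi.single b.2 1) - θ b.1) +
          ∑ b : Bond L, κ b / 2 * Real.cos (2 * (θ (b.1 + Pi.single b.2 1) - θ b.1))) := by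
  have hs : -(∑ b : Bond L, κ b * cur b θ ^ 2) =
      ∑ b : Bond L, (κ b / 2 * Real.cos (2 * (θ (b.1 + Pi.single b.2 1) - θ b.1)) - κ b / 2) := by
    rw [← Finset.sum_neg_distrib]
    exact Finset.sum_congr rfl fun b _ => gr_neg_mul_sin_sq (κ b) _
  rw [hs, Finset.sum_sub_distrib]
  ring

/-- In angles, the square of a relative-angle character has real part the second harmonic:
`Re (θ̄_y θ_x)²(e^{iθ}) = cos(2(θ_x − θ_y))`. -/
theorem gr_reChar_diffChar_sq_exp {V : Type*} (x y : V) (θ : V → ℝ) :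
    reChar (diffChar y x * diffChar y x) (fun v => Circle.exp (θ v)) = Real.cos (2 * (θ x - θ y)) := by
  rw [reChar, ContinuousMonoidHom.mul_apply, diffChar_apply, ← Circle.exp_neg, ← Circle.exp_add,
    ← Circle.exp_add, neg_add_eq_sub, Circle.coe_exp, Complex.exp_ofReal_mul_I_re, two_mul]

/-- In angles, the Ginibre weight of the extended family (bond characters `χ_b` with couplings `J`, their
squares `χ_b²` with couplings `κ_b/2`) is `exp(J Σ_b cos ∇_b θ + Σ_b (κ_b/2) cos 2∇_b θ)`. -/
theorem gr_ginibreWeight_ext_exp [NeZero L] (κ : Bond L → ℝ) (J : ℝ) (θ : TorusSite 3 L → ℝ) :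
    ginibreWeight
        (Sum.elim (fun b : Bond L => diffChar b.1 (b.1 + Pi.single b.2 1))
          (fun b : Bond L => diffChar b.1 (b.1 + Pi.single b.2 1) * diffChar b.1 (b.1 + Pi.single b.2 1)))
        (Sum.elim (fun _ : Bond L => J) (fun b : Bond L => κ b / 2)) (fun v => Circle.exp (θ v)) =
      Real.exp (J * ∑ b : Bond L, Real.cos (θ (b.1 + Pi.single b.2 1) - θ b.1) +
        ∑ b : Bond L, κ b / 2 * Real.cos (2 * (θ (b.1 + Pi.single b.2 1) - θ b.1))) := by
  rw [ginibreWeight, ginibreHamiltonian, Fintype.sum_sum_type]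
  simp only [Sum.elim_inl, Sum.elim_inr, reChar_diffChar_exp, gr_reChar_diffChar_sq_exp, Finset.mul_sum]

/-- With the second-harmonic couplings switched off, the extended Ginibre weight is the plain rotator weight. -/
theorem gr_ginibreWeight_ext_zero [NeZero L] (J : ℝ) (u : TorusSite 3 L → Circle) :
    ginibreWeight
        (Sum.elim (fun b : Bond L => diffChar b.1 (b.1 + Pi.single b.2 1))
          (fun b : Bond L => diffChar b.1 (b.1 + Pi.single b.2 1) * diffChar b.1 (b.1 + Pi.single b.2 1)))
        (Sum.elim (fun _ : Bond L => J) (fun _ : Bond L => 0)) u =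
      ginibreWeight (fun b : Bond L => diffChar b.1 (b.1 + Pi.single b.2 1)) (fun _ => J) u := by
  simp [ginibreWeight, ginibreHamiltonian, Fintype.sum_sum_type]

/-- **Ginibre's second inequality on the ray**: at `J ≥ 0`, switching on the ferromagnetic second-harmonic
couplings `κ_b/2 ≥ 0` does not decrease any two-point function `⟨Re θ̄_y θ_x⟩` of the rotator on `U(1)^Λ`. -/
theorem gr_twoPoint_mono [NeZero L] {κ : Bond L → ℝ} (hκ : ∀ b, 0 ≤ κ b) {J : ℝ} (hJ : 0 ≤ J)
    (x y : TorusSite 3 L) :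
    ginibreExpect (torusHaar (TorusSite 3 L)) (fun b : Bond L => diffChar b.1 (b.1 + Pi.single b.2 1))
        (fun _ => J) (reChar (diffChar y x)) ≤
      ginibreExpect (torusHaar (TorusSite 3 L))
        (Sum.elim (fun b : Bond L => diffChar b.1 (b.1 + Pi.single b.2 1))
          (fun b : Bond L => diffChar b.1 (b.1 + Pi.single b.2 1) * diffChar b.1 (b.1 + Pi.single b.2 1)))
        (Sum.elim (fun _ : Bond L => J) (fun b : Bond L => κ b / 2)) (reChar (diffChar y x)) := by
  have h0 : ginibreExpect (torusHaar (TorusSite 3 L)) (fun b : Bond L => diffChar b.1 (b.1 + Pi.single b.2 1))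
        (fun _ => J) (reChar (diffChar y x)) =
      ginibreExpect (torusHaar (TorusSite 3 L))
        (Sum.elim (fun b : Bond L => diffChar b.1 (b.1 + Pi.single b.2 1))
          (fun b : Bond L => diffChar b.1 (b.1 + Pi.single b.2 1) * diffChar b.1 (b.1 + Pi.single b.2 1)))
        (Sum.elim (fun _ : Bond L => J) (fun _ : Bond L => 0)) (reChar (diffChar y x)) := by
    unfold ginibreExpect
    simp_rw [gr_ginibreWeight_ext_zero]
  rw [h0]
  refine ginibreExpect_reChar_mono _ surjective_mul_self_torus _ _ (fun a => ?_) (fun a => ?_)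
  · cases a with
    | inl b => exact hJ
    | inr b => exact le_rfl
  · cases a with
    | inl b => exact le_rfl
    | inr b => exact div_nonneg (hκ b) zero_le_two

/-- **On the Ginibre ray the complex integrand `w_J e^{W_K}` is a positive constant times the extended Ginibre
weight at `e^{iθ}`** (in particular it is real and positive). -/
theorem gr_integrand_eq [NeZero L] (κ : Bond L → ℝ) (J : ℝ) (θ : TorusSite 3 L → ℝ) :
    wJ J θ * Complex.exp (Wk (fun b b' : Bond L => if b = b' then -((κ b : ℝ) : ℂ) else 0) θ) =
      ((Real.exp (-(∑ b : Bond L, κ b / 2)) *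
          ginibreWeight
            (Sum.elim (fun b : Bond L => diffChar b.1 (b.1 + Pi.single b.2 1))
              (fun b : Bond L => diffChar b.1 (b.1 + Pi.single b.2 1) * diffChar b.1 (b.1 + Pi.single b.2 1)))
            (Sum.elim (fun _ : Bond L => J) (fun b : Bond L => κ b / 2)) (fun v => Circle.exp (θ v)) : ℝ) : ℂ) := by
  rw [gr_Wk_kernel, ← Complex.ofReal_exp]
  unfold wJ
  rw [← Complex.ofReal_mul]
  congr 1
  rw [gr_ginibreWeight_ext_exp, ← Real.exp_add, ← Real.exp_add, gr_exponent_eq]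

/-! ### The stub -/

/-- STUB (c5 delineation, M): **the Ginibre ray.** On the cone of non-positive real DIAGONAL kernels `K = −κ_b δ_{bb'}`,
`κ_b ≥ 0` (a ferromagnetic second harmonic: `W_K = −Σ_b κ_b sin²∇_bθ = Σ_b (κ_b/2)(cos 2∇_bθ − 1)`), the crux's conclusion holds
UNIFORMLY IN `L` and at EVERY amplitude (no `ε`): `Z_K ≠ 0` (a positive real) and the plateau is at least the `K = 0` plateau
`a₀` of the landed `realPlateau`, by Ginibre's second inequality (tree: `ginibreExpect_reChar_mono` on `U(1)^Λ` for the
characters `χ_b = θ̄_x θ_{x+e_i}` with couplings `J` and `χ_b²` with couplings `κ_b/2 ≥ 0`; angle cube ↔ Haar by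
`setIntegral_angleCube_comp_exp`; `K = 0` side = `odd_re_cratio_zero` + `odd_twoPoint_div_eq_ginibreExpect`). -/
theorem stub_ginibreRay :
    ∃ J₁ a : ℝ, 0 < a ∧ ∀ J : ℝ, J₁ ≤ J → ∀ (L : ℕ) [NeZero L], 2 ≤ L →
      ∀ κ : Bond L → ℝ, (∀ b, 0 ≤ κ b) →
        Zk J (fun b b' : Bond L => if b = b' then -((κ b : ℝ) : ℂ) else 0) ≠ 0 ∧
          a ≤ (cratio L J (fun b b' : Bond L => if b = b' then -((κ b : ℝ) : ℂ) else 0)).re := by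
  obtain ⟨J₁, a₀, ha₀, hplat⟩ := realPlateau
  refine ⟨max J₁ 0, a₀, ha₀, fun J hJ L _ hL κ hκ => ?_⟩
  have hJ₁ : J₁ ≤ J := le_trans (le_max_left _ _) hJ
  have hJ0 : 0 ≤ J := le_trans (le_max_right _ _) hJ
  have hC : 0 < Real.exp (-(∑ b : Bond L, κ b / 2)) := Real.exp_pos _
  have hint := gr_integrand_eq (L := L) κ J
  refine ⟨?_, ?_⟩
  · rw [gr_Zk_eq_of hint, Ne, Complex.ofReal_eq_zero]
    exact (gr_setIntegral_cube_ginibreWeight_pos _ _ hC).ne'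
  · calc a₀ ≤ (cratio L J 0).re := (hplat J hJ₁ L hL).1
      _ = (∑ x : TorusSite 3 L, ∑ y : TorusSite 3 L,
            ginibreExpect (torusHaar (TorusSite 3 L)) (fun b : Bond L => diffChar b.1 (b.1 + Pi.single b.2 1))
              (fun _ => J) (reChar (diffChar y x))) / (L : ℝ) ^ 6 := by
          rw [odd_re_cratio_zero]
          simp_rw [odd_twoPoint_div_eq_ginibreExpect]
      _ ≤ (∑ x : TorusSite 3 L, ∑ y : TorusSite 3 L,
            ginibreExpect (torusHaar (TorusSite 3 L))
              (Sum.elim (fun b : Bond L => diffChar b.1 (b.1 + Pi.single b.2 1))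
                (fun b : Bond L => diffChar b.1 (b.1 + Pi.single b.2 1) * diffChar b.1 (b.1 + Pi.single b.2 1)))
              (Sum.elim (fun _ : Bond L => J) (fun b : Bond L => κ b / 2)) (reChar (diffChar y x))) / (L : ℝ) ^ 6 :=
          div_le_div_of_nonneg_right
            (Finset.sum_le_sum fun x _ => Finset.sum_le_sum fun y _ => gr_twoPoint_mono hκ hJ0 x y)
            (by positivity)
      _ = (cratio L J (fun b b' : Bond L => if b = b' then -((κ b : ℝ) : ℂ) else 0)).re := by
          rw [gr_re_cratio_of hint]
          simp_rw [gr_twoPoint_div_eq_ginibreExpect _ _ hC.ne']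

end Summit.HubbardSuperconductivity.HubbardSuperconductivity.Theorems.PerturbedXYOrder

end
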